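import Literature.Geometry.Kaehler.ComplexTorusAntisymplecticGraphQuotient
import Literature.Geometry.Kaehler.ComplexTorusKHIsotropicDecomposition
import HarnessLib

/-!
# Antisymplectic isomorphisms `K(θ_Y) ≅ K(θ_Z)` for complementary types: Iribar López's
# `f_Z ∘ r ∘ f_Y⁻¹` (the map `r : K(δ) → K(δ̃)` exchanging the two factors of `(ℤ^u/δ)²`)

Layer `Literature/Geometry/Kaehler`, namespace `Literature.Geometry.Kaehler.ComplexTorus`; lane `lit-hodgefound`
(Track 2 foundations library, Layer A4), seat `lit-hodgefound-skel-4` (gen 26), row **A4-76**, FILE F.  Sequel of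
`ComplexTorusAntisymplecticGraphQuotient.lean` (FILE A: for a bijective ANTISYMPLECTIC `p : K(L₁) → K(L₂)` the
twisted product `(Y × Z)/graph(p)` is principally polarised by the descended `ω₁ ⊠ ω₂`) and of skel-2's
`ComplexTorusKHDecomposition.lean` / `ComplexTorusKHIsotropicDecomposition.lean` (symplectic coordinates
`x = Σ xᵢλᵢ + Σ x′ᵢμᵢ`, `K(L)` in coordinates, `E = Σ dᵢ(xᵢy′ᵢ − x′ᵢyᵢ)`, the Weil pairing `ẽ^L = e(−2πi E)` on
`K(L)`).

## The statement formalised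

Iribar López [§2.2 Def. 4, p. 8]: «define the morphism `𝒫_{g,δ} : 𝒜^{lev}_{u,δ} × 𝒜^{lev}_{g−u,δ̃} → 𝒜_g`
sending the pair `((Y, θ_Y, f_Y), (Z, θ_Z, f_Z))` to `((Y × Z)/graph(f_Z ∘ r ∘ f_Y⁻¹), θ_{f_Z ∘ r ∘ f_Y⁻¹})`, where
`r : K(δ) → K(δ̃) = K(δ)` is the antisymplectic isomorphism that exchanges the factors `(ℤ^g/δ) × 0` and
`0 × (ℤ^g/δ)`.»  Here `δ = (d₁, …, d_u)`, `δ̃ = (1, …, 1, d₁, …, d_u)` (`g − 2u` ones) is the complementary type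
[§2.2, p. 7], `K(δ) = (ℤ^u/δℤ^u)²` with its standard symplectic form [§2.1, p. 5: «a level structure is a
symplectic isomorphism `f : A[δ] := ker(θ) → (ℤ^g/δℤ^g)²`»], and `K(δ̃) = K(δ)` because the entries `1` of
`δ̃` contribute trivial factors.  So for ANY polarised abelian varieties `(Y, θ_Y)` of type `δ` and
`(Z, θ_Z)` of type `δ̃` there is an antisymplectic isomorphism `K(θ_Y) ≅ K(θ_Z)` — the input of Lemma 10 /
FILE A — namely `f_Z ∘ r ∘ f_Y⁻¹` for level structures `f_Y`, `f_Z`.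

At torus level a symplectic basis `λ₁, …, λ_u, μ₁, …, μ_u` of `Λ_Y` of type `δ` IS a level structure
(`K(θ_Y) = ⊕ ℤλᵢ/dᵢ ⊕ ℤμᵢ/dᵢ / Λ_Y ≅ (ℤ^u/δ)²`, Exercise 1.5.5 (5) — tree `proj_mem_kerPhiH_iff_coord`), and
`f_Z ∘ r ∘ f_Y⁻¹` is induced by the INTEGER matrix `R : Λ_Y → Λ_Z`, `λᵢ ↦ μ′_{σ(i)}`, `μᵢ ↦ λ′_{σ(i)}`, where
`σ : {1..u} ↪ {1..v}` matches the entries of `δ` with the equal entries of `δ̃` (`σ(i) = (v − u) + i`) and the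
unmatched entries of `δ̃` are `1`.  This file proves, for such `R` (`levelSwapMatrix`):

* `twoForm_levelSwapMatrix_mulVec` (§2): `E_Z(Rx, Ry) = −E_Y(x, y)` — `R` is "antisymplectic" on the real
  symplectic coordinates;
* `proj_levelSwapMatrix_mulVec_mem_kerPhiH_iff` (§3): `ρ(R)(x̄) ∈ K(θ_Z) ↔ x̄ ∈ K(θ_Y)`;
  `mapMatrix_levelSwapMatrix_injective`: `ρ(R) : Y → Z` is injective (as a homomorphism of real tori);
  `exists_mapMatrix_levelSwapMatrix_eq_of_mem_kerPhiH`: `ρ(R)` maps `K(θ_Y)` ONTO `K(θ_Z)` (this is where the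
  unmatched entries `1` of `δ̃` enter);
* `weilPairing_mapMatrix_levelSwapMatrix` (§4): `ẽ^{θ_Z}(R s, R t) = ẽ^{θ_Y}(s, t)⁻¹` on `K(θ_Y)`;
* `exists_antisymplectic_addEquiv_kerPhiH` (§5): hence an antisymplectic isomorphism
  `p : K(θ_Y) ≃+ K(θ_Z)` (`IsAntisymplectic` of FILE A) with `p = ρ(R)|_{K(θ_Y)}`;
* `IsPolarizationType.exists_antisymplectic_addEquiv_kerPhiH[_append|_of_eq]` (§6): the statement in the
  tree's language of types — polarised tori of types `δ` and `δ̃ = (1^k, δ)` (any `k`), or of the same type,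
  have antisymplectically isomorphic `K`'s;
* `IsPolarizationType.exists_isPrincipalPolarization_quotientBy_graphSubgroup_append` (§7): with FILE A,
  **for every `(Y, ω₁)` of type `δ` and `(Z, ω₂)` of type `δ̃` there is a bijective antisymplectic
  `p : K(L₁) → K(L₂)` and `(Y × Z)/graph(p)` is principally polarised by the descended `ω₁ ⊠ ω₂`** — Debarre's
  morphism `𝒫_{g,δ}` (Auffarth's `Φ_{u,n−u}(D) : 𝒜_u(D) × 𝒜_{n−u}(D̃) → 𝒜^D_{u,n−u}`) is defined on ALL pairs of
  the complementary types.

## Method (the printed construction, in coordinates)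

`R` maps the basis vector `b₁ k` of `Λ_Y` to the basis vector `b₂ (τ k)` of `Λ_Z`, `τ` the injective index map
`λᵢ ↦ μ′_{σ i}`, `μᵢ ↦ λ′_{σ i}` (`levelSwapIndex`); hence the `b₂`-coordinates of `R_ℝ x` are the `b₁`-coordinates
of `x` moved along `τ` and `0` at the unmatched indices (`repr_levelSwapMatrix_mulVec`).  Everything else is read off
the coordinate descriptions of skel-2's files: `E = Σ dᵢ(xᵢy′ᵢ − x′ᵢyᵢ)` (`twoForm_eq_sum_symplecticCoord`) gives
§2 (the swap `xᵢ ↔ x′ᵢ` changes the sign, `d′_{σ i} = dᵢ`, unmatched terms vanish); `x̄ ∈ K(L) ↔ dᵢxᵢ, dᵢx′ᵢ ∈ ℤ`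
(`proj_mem_kerPhiH_iff_coord`) gives §3 (for the surjectivity: a point of `K(θ_Z)` has INTEGER coordinates at the
unmatched indices since `d′ⱼ = 1` there, so it is `ρ(R)` of the point of `Y` with the matched coordinates, up to
a lattice vector); `ẽ^L(x̄, ȳ) = e(−2πi E(x, y))` (`weilPairing_proj_proj`) gives §4.  No new notions beyond the
two bookkeeping definitions `levelSwapIndex`, `levelSwapMatrix`; no named facts (net debt 0).

## References

* [IribarLopez2024NoetherLefschetzCycles] A. Iribar López, *Noether–Lefschetz cycles on the moduli space of
  abelian varieties*, arXiv:2411.09910 (2024), §2.1 (p. 5: level structures), §2.2 Lemma 10 and Definition 4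
  (pp. 7–8: `r : K(δ) → K(δ̃)`, `𝒫_{g,δ}`).
* [Auffarth2016NonSimplePPAV] R. Auffarth, *A structure theorem for non-simple principally polarized abelian
  varieties*, Math. Z. 282 (2016), §3 (the anti-symplectic involution `ε` of `K(D) = K(D̃)`, the morphism
  `Φ_{u,n−u}(D)`).
* [Debarre1988ThetaSingulierCodim3] O. Debarre, *Sur les variétés abéliennes dont le diviseur thêta est
  singulier en codimension 3*, Duke Math. J. 57 (1988) (the original construction).
* [Lange2023AbelianVarietiesComplex] H. Lange, *Abelian Varieties over the Complex Numbers* (2023), §1.5.1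
  (symplectic bases, the matrix `(0 D; −D 0)`), §1.5.4 Exercise 1.5.5 (5) (`K(L) = K₁ ⊕ K₂ ≅ (⊕ ℤ/dᵢ)²`),
  §2.7.1 (2.13) and Thm. 2.7.7 (`ẽ^L = e(−2πi E)`), §5.3.1 Cor. 5.3.5 (complementary types).
-/

noncomputable section

open Complex Module Function Real Matrix

namespace Literature.Geometry.Kaehler

namespace ComplexTorus

variable {ι₁ ι₂ : Type*} [Fintype ι₁] [Fintype ι₂] [DecidableEq ι₁] [DecidableEq ι₂]
  {E₁ E₂ : Type*} [NormedAddCommGroup E₁] [NormedSpace ℂ E₁] [NormedAddCommGroup E₂] [NormedSpace ℂ E₂]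
  {Φ₁ : (ι₁ → ℝ) ≃L[ℝ] E₁} {Φ₂ : (ι₂ → ℝ) ≃L[ℝ] E₂} {ω₁ : E₁ [⋀^Fin 2]→L[ℝ] ℝ} {ω₂ : E₂ [⋀^Fin 2]→L[ℝ] ℝ}
  {u v : ℕ}

/-! ### §1 The index map `λᵢ ↦ μ′_{σ i}`, `μᵢ ↦ λ′_{σ i}` and the integer matrix `R` of `f_Z ∘ r ∘ f_Y⁻¹` -/

section Swap

variable (e₁ : Fin u ⊕ Fin u ≃ ι₁) (e₂ : Fin v ⊕ Fin v ≃ ι₂) (σ : Fin u → Fin v)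

/-- **The index map of `r`**: `τ(λᵢ) = μ′_{σ(i)}`, `τ(μᵢ) = λ′_{σ(i)}` on the index types `ι₁ ≃ {1..u} ⊔ {1..u}`,
`ι₂ ≃ {1..v} ⊔ {1..v}` of the two symplectic bases («exchanges the factors `(ℤ^g/δ) × 0` and `0 × (ℤ^g/δ)`»).
[cite: IribarLopez2024NoetherLefschetzCycles, §2.2 Def. 4 (p. 8)] -/
def levelSwapIndex (k : ι₁) : ι₂ := e₂ (Sum.swap (Sum.map σ σ (e₁.symm k)))

omit [Fintype ι₁] [Fintype ι₂] [DecidableEq ι₁] [DecidableEq ι₂] in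
/-- `τ(λᵢ) = μ′_{σ i}`. [cite: IribarLopez2024NoetherLefschetzCycles, §2.2 Def. 4 (p. 8)] -/
@[simp] theorem levelSwapIndex_inl (i : Fin u) : levelSwapIndex e₁ e₂ σ (e₁ (Sum.inl i)) = e₂ (Sum.inr (σ i)) := by
  simp [levelSwapIndex]

omit [Fintype ι₁] [Fintype ι₂] [DecidableEq ι₁] [DecidableEq ι₂] in
/-- `τ(μᵢ) = λ′_{σ i}`. [cite: IribarLopez2024NoetherLefschetzCycles, §2.2 Def. 4 (p. 8)] -/
@[simp] theorem levelSwapIndex_inr (i : Fin u) : levelSwapIndex e₁ e₂ σ (e₁ (Sum.inr i)) = e₂ (Sum.inl (σ i)) := by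
  simp [levelSwapIndex]

omit [Fintype ι₁] [Fintype ι₂] [DecidableEq ι₁] [DecidableEq ι₂] in
/-- `τ` is injective when `σ` is. [cite: IribarLopez2024NoetherLefschetzCycles, §2.2 Def. 4 (p. 8)] -/
theorem levelSwapIndex_injective (hσ : Injective σ) : Injective (levelSwapIndex e₁ e₂ σ) := by
  intro k l h
  have h1 : Sum.map σ σ (e₁.symm k) = Sum.map σ σ (e₁.symm l) := by
    have h2 := congrArg Sum.swap (e₂.injective h)
    simpa using h2
  exact e₁.symm.injective ((Sum.map_injective.2 ⟨hσ, hσ⟩) h1)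

omit [Fintype ι₁] [Fintype ι₂] [DecidableEq ι₁] [DecidableEq ι₂] in
/-- An unmatched `λ′ⱼ` (`j ∉ σ({1..u})`) is not in the image of `τ`. [cite: IribarLopez2024NoetherLefschetzCycles, §2.2 Def. 4 (p. 8)] -/
theorem levelSwapIndex_ne_inl {j : Fin v} (hj : ∀ i, σ i ≠ j) (k : ι₁) : levelSwapIndex e₁ e₂ σ k ≠ e₂ (Sum.inl j) := by
  intro h
  have h' := e₂.injective h
  obtain ⟨s, rfl⟩ := e₁.surjective k
  rw [Equiv.symm_apply_apply] at h'
  cases s with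
  | inl i => simp at h'
  | inr i =>
    simp only [Sum.map_inr, Sum.swap_inr, Sum.inl.injEq] at h'
    exact hj i h'

omit [Fintype ι₁] [Fintype ι₂] [DecidableEq ι₁] [DecidableEq ι₂] in
/-- An unmatched `μ′ⱼ` (`j ∉ σ({1..u})`) is not in the image of `τ`. [cite: IribarLopez2024NoetherLefschetzCycles, §2.2 Def. 4 (p. 8)] -/
theorem levelSwapIndex_ne_inr {j : Fin v} (hj : ∀ i, σ i ≠ j) (k : ι₁) : levelSwapIndex e₁ e₂ σ k ≠ e₂ (Sum.inr j) := by
  intro h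
  have h' := e₂.injective h
  obtain ⟨s, rfl⟩ := e₁.surjective k
  rw [Equiv.symm_apply_apply] at h'
  cases s with
  | inl i =>
    simp only [Sum.map_inl, Sum.swap_inl, Sum.inr.injEq] at h'
    exact hj i h'
  | inr i => simp at h'

variable (b₁ : Basis ι₁ ℤ (ι₁ → ℤ)) (b₂ : Basis ι₂ ℤ (ι₂ → ℤ))

/-- **The integer matrix `R` of `f_Z ∘ r ∘ f_Y⁻¹` on the lattices**: the `ℤ`-linear map `Λ_Y → Λ_Z` with
`R(b₁ k) = b₂ (τ k)` — `λᵢ ↦ μ′_{σ i}`, `μᵢ ↦ λ′_{σ i}` for the symplectic bases `b₁ = (λ, μ)` of `Λ_Y` and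
`b₂ = (λ′, μ′)` of `Λ_Z` (the rational representation of the homomorphism of real tori inducing
`f_Z ∘ r ∘ f_Y⁻¹` on `K(θ_Y)`). [cite: IribarLopez2024NoetherLefschetzCycles, §2.2 Def. 4 (p. 8)] [cite: Lange2023AbelianVarietiesComplex, §1.5.4 Exercise 1.5.5 (5)] -/
def levelSwapMatrix : Matrix ι₂ ι₁ ℤ :=
  LinearMap.toMatrix' (b₁.constr ℤ fun k ↦ (b₂ (levelSwapIndex e₁ e₂ σ k) : ι₂ → ℤ))

omit [Fintype ι₂] [DecidableEq ι₂] in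
/-- `R (b₁ k) = b₂ (τ k)`. [cite: IribarLopez2024NoetherLefschetzCycles, §2.2 Def. 4 (p. 8)] -/
theorem levelSwapMatrix_mulVec_basis (k : ι₁) : levelSwapMatrix e₁ e₂ σ b₁ b₂ *ᵥ b₁ k = b₂ (levelSwapIndex e₁ e₂ σ k) := by
  rw [levelSwapMatrix, LinearMap.toMatrix'_mulVec, Basis.constr_basis]

/-- `R_ℝ (b₁ k) = b₂ (τ k)` on the real symplectic coordinates. [cite: Lange2023AbelianVarietiesComplex, §1.5.1 (chunk p0051)] -/
theorem levelSwapMatrix_mulVec_realLatticeBasis (k : ι₁) :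
    (levelSwapMatrix e₁ e₂ σ b₁ b₂).map (Int.cast : ℤ → ℝ) *ᵥ realLatticeBasis b₁ k =
      realLatticeBasis b₂ (levelSwapIndex e₁ e₂ σ k) := by
  rw [realLatticeBasis_apply, intVec_mulVec, levelSwapMatrix_mulVec_basis, realLatticeBasis_apply]

/-- `R_ℝ x = Σ_k x_k · b₂(τ k)` for `x = Σ_k x_k · b₁ k`. [cite: Lange2023AbelianVarietiesComplex, §1.5.1 (chunk p0051)] -/
theorem levelSwapMatrix_mulVec_eq_sum (x : ι₁ → ℝ) :
    (levelSwapMatrix e₁ e₂ σ b₁ b₂).map (Int.cast : ℤ → ℝ) *ᵥ x =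
      ∑ k, (realLatticeBasis b₁).repr x k • realLatticeBasis b₂ (levelSwapIndex e₁ e₂ σ k) := by
  conv_lhs => rw [← (realLatticeBasis b₁).sum_repr x]
  rw [Matrix.mulVec_sum]
  exact Finset.sum_congr rfl fun k _ ↦ by rw [Matrix.mulVec_smul, levelSwapMatrix_mulVec_realLatticeBasis]

/-- **The coordinates of `R_ℝ x`**: the `b₂`-coordinate of `R_ℝ x` at `k′` is the `b₁`-coordinate of `x` at
`τ⁻¹(k′)` (and `0` if `k′` is unmatched). [cite: IribarLopez2024NoetherLefschetzCycles, §2.2 Def. 4 (p. 8)] [cite: Lange2023AbelianVarietiesComplex, §1.5.1 (chunk p0051)] -/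
theorem repr_levelSwapMatrix_mulVec (x : ι₁ → ℝ) (k' : ι₂) :
    (realLatticeBasis b₂).repr ((levelSwapMatrix e₁ e₂ σ b₁ b₂).map (Int.cast : ℤ → ℝ) *ᵥ x) k' =
      ∑ k, if levelSwapIndex e₁ e₂ σ k = k' then (realLatticeBasis b₁).repr x k else 0 := by
  rw [levelSwapMatrix_mulVec_eq_sum, map_sum, Finsupp.finsetSum_apply]
  refine Finset.sum_congr rfl fun k _ ↦ ?_
  rw [map_smul, Basis.repr_self, Finsupp.smul_apply, Finsupp.single_apply, smul_eq_mul, mul_ite, mul_one,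
    mul_zero]

/-- The matched coordinates: `(R_ℝ x)_{τ k} = x_k`. [cite: IribarLopez2024NoetherLefschetzCycles, §2.2 Def. 4 (p. 8)] -/
theorem repr_levelSwapMatrix_mulVec_levelSwapIndex (hσ : Injective σ) (x : ι₁ → ℝ) (k : ι₁) :
    (realLatticeBasis b₂).repr ((levelSwapMatrix e₁ e₂ σ b₁ b₂).map (Int.cast : ℤ → ℝ) *ᵥ x) (levelSwapIndex e₁ e₂ σ k) =
      (realLatticeBasis b₁).repr x k := by
  rw [repr_levelSwapMatrix_mulVec, Finset.sum_eq_single k]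
  · rw [if_pos rfl]
  · intro l _ hl
    rw [if_neg fun h ↦ hl (levelSwapIndex_injective e₁ e₂ σ hσ h)]
  · intro h
    exact absurd (Finset.mem_univ k) h

/-- The unmatched coordinates vanish: `(R_ℝ x)_{k′} = 0` for `k′ ∉ τ(ι₁)`. [cite: IribarLopez2024NoetherLefschetzCycles, §2.2 Def. 4 (p. 8)] -/
theorem repr_levelSwapMatrix_mulVec_of_ne (x : ι₁ → ℝ) {k' : ι₂} (hk' : ∀ k, levelSwapIndex e₁ e₂ σ k ≠ k') :
    (realLatticeBasis b₂).repr ((levelSwapMatrix e₁ e₂ σ b₁ b₂).map (Int.cast : ℤ → ℝ) *ᵥ x) k' = 0 := by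
  rw [repr_levelSwapMatrix_mulVec]
  exact Finset.sum_eq_zero fun k _ ↦ if_neg (hk' k)

/-- `(R_ℝ x)` has `λ′_{σ i}`-coordinate `x′ᵢ` (the `μᵢ`-coordinate of `x`). [cite: IribarLopez2024NoetherLefschetzCycles, §2.2 Def. 4 (p. 8)] -/
theorem repr_levelSwapMatrix_mulVec_inl (hσ : Injective σ) (x : ι₁ → ℝ) (i : Fin u) :
    (realLatticeBasis b₂).repr ((levelSwapMatrix e₁ e₂ σ b₁ b₂).map (Int.cast : ℤ → ℝ) *ᵥ x) (e₂ (Sum.inl (σ i))) =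
      (realLatticeBasis b₁).repr x (e₁ (Sum.inr i)) := by
  rw [← levelSwapIndex_inr e₁ e₂ σ i, repr_levelSwapMatrix_mulVec_levelSwapIndex e₁ e₂ σ b₁ b₂ hσ]

/-- `(R_ℝ x)` has `μ′_{σ i}`-coordinate `xᵢ` (the `λᵢ`-coordinate of `x`). [cite: IribarLopez2024NoetherLefschetzCycles, §2.2 Def. 4 (p. 8)] -/
theorem repr_levelSwapMatrix_mulVec_inr (hσ : Injective σ) (x : ι₁ → ℝ) (i : Fin u) :
    (realLatticeBasis b₂).repr ((levelSwapMatrix e₁ e₂ σ b₁ b₂).map (Int.cast : ℤ → ℝ) *ᵥ x) (e₂ (Sum.inr (σ i))) =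
      (realLatticeBasis b₁).repr x (e₁ (Sum.inl i)) := by
  rw [← levelSwapIndex_inl e₁ e₂ σ i, repr_levelSwapMatrix_mulVec_levelSwapIndex e₁ e₂ σ b₁ b₂ hσ]

/-- Unmatched `λ′ⱼ`-coordinates of `R_ℝ x` vanish. [cite: IribarLopez2024NoetherLefschetzCycles, §2.2 Def. 4 (p. 8)] -/
theorem repr_levelSwapMatrix_mulVec_inl_of_forall_ne (x : ι₁ → ℝ) {j : Fin v} (hj : ∀ i, σ i ≠ j) :
    (realLatticeBasis b₂).repr ((levelSwapMatrix e₁ e₂ σ b₁ b₂).map (Int.cast : ℤ → ℝ) *ᵥ x) (e₂ (Sum.inl j)) = 0 :=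
  repr_levelSwapMatrix_mulVec_of_ne e₁ e₂ σ b₁ b₂ x (levelSwapIndex_ne_inl e₁ e₂ σ hj)

/-- Unmatched `μ′ⱼ`-coordinates of `R_ℝ x` vanish. [cite: IribarLopez2024NoetherLefschetzCycles, §2.2 Def. 4 (p. 8)] -/
theorem repr_levelSwapMatrix_mulVec_inr_of_forall_ne (x : ι₁ → ℝ) {j : Fin v} (hj : ∀ i, σ i ≠ j) :
    (realLatticeBasis b₂).repr ((levelSwapMatrix e₁ e₂ σ b₁ b₂).map (Int.cast : ℤ → ℝ) *ᵥ x) (e₂ (Sum.inr j)) = 0 :=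
  repr_levelSwapMatrix_mulVec_of_ne e₁ e₂ σ b₁ b₂ x (levelSwapIndex_ne_inr e₁ e₂ σ hj)

omit [Fintype ι₁] [DecidableEq ι₁] in
/-- The coordinates of a lattice vector are its (integer) `b`-coordinates. [cite: Lange2023AbelianVarietiesComplex, §1.5.1 (chunk p0051)] -/
theorem realLatticeBasis_repr_intVec (b : Basis ι₂ ℤ (ι₂ → ℤ)) (n : ι₂ → ℤ) (k : ι₂) :
    (realLatticeBasis b).repr (intVec n) k = (b.repr n k : ℝ) := by
  rw [intVec_eq_sum_repr b n, Basis.repr_sum_self]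

end Swap

/-! ### §2 `E_Z(Rx, Ry) = −E_Y(x, y)`: `R` is antisymplectic on the real symplectic coordinates -/

section Form

variable {e₁ : Fin u ⊕ Fin u ≃ ι₁} {e₂ : Fin v ⊕ Fin v ≃ ι₂} {σ : Fin u → Fin v}
  {b₁ : Basis ι₁ ℤ (ι₁ → ℤ)} {b₂ : Basis ι₂ ℤ (ι₂ → ℤ)} {d : Fin u → ℕ} {d' : Fin v → ℕ}
  (huu₁ : ∀ i j, ω₁ ![Φ₁ (intVec (b₁ (e₁ (Sum.inl i)))), Φ₁ (intVec (b₁ (e₁ (Sum.inl j))))] = 0)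
  (hvv₁ : ∀ i j, ω₁ ![Φ₁ (intVec (b₁ (e₁ (Sum.inr i)))), Φ₁ (intVec (b₁ (e₁ (Sum.inr j))))] = 0)
  (huv₁ : ∀ i j, ω₁ ![Φ₁ (intVec (b₁ (e₁ (Sum.inl i)))), Φ₁ (intVec (b₁ (e₁ (Sum.inr j))))] =
    if i = j then (d i : ℝ) else 0)
  (huu₂ : ∀ i j, ω₂ ![Φ₂ (intVec (b₂ (e₂ (Sum.inl i)))), Φ₂ (intVec (b₂ (e₂ (Sum.inl j))))] = 0)
  (hvv₂ : ∀ i j, ω₂ ![Φ₂ (intVec (b₂ (e₂ (Sum.inr i)))), Φ₂ (intVec (b₂ (e₂ (Sum.inr j))))] = 0)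
  (huv₂ : ∀ i j, ω₂ ![Φ₂ (intVec (b₂ (e₂ (Sum.inl i)))), Φ₂ (intVec (b₂ (e₂ (Sum.inr j))))] =
    if i = j then (d' i : ℝ) else 0)
  (hσ : Injective σ) (hdσ : ∀ i, d' (σ i) = d i)

omit [Fintype ι₁] [Fintype ι₂] [DecidableEq ι₁] [DecidableEq ι₂] in
include hσ in
/-- A sum over `{1..v}` of terms vanishing at the unmatched indices is the sum over `σ({1..u})`. [folklore] -/
private theorem sum_eq_sum_comp_of_injective {M : Type*} [AddCommMonoid M] (f : Fin v → M)
    (hf : ∀ j, (∀ i, σ i ≠ j) → f j = 0) : ∑ j, f j = ∑ i, f (σ i) := by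
  have h1 : ∑ i, f (σ i) = ∑ x ∈ Finset.univ.map ⟨σ, hσ⟩, f x := by
    rw [Finset.sum_map]
    rfl
  rw [h1]
  exact (Finset.sum_subset (Finset.subset_univ _) fun j _ hj ↦
    hf j fun i h ↦ hj (Finset.mem_map.2 ⟨i, Finset.mem_univ _, h⟩)).symm

omit [Fintype ι₁] [Fintype ι₂] [DecidableEq ι₁] [DecidableEq ι₂] in
/-- A property holding at the unmatched indices holds everywhere iff it holds on `σ({1..u})`. [folklore] -/
private theorem forall_iff_forall_comp (P : Fin v → Prop) (hP : ∀ j, (∀ i, σ i ≠ j) → P j) :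
    (∀ j, P j) ↔ ∀ i, P (σ i) := by
  refine ⟨fun h i ↦ h (σ i), fun h j ↦ ?_⟩
  by_cases hj : ∃ i, σ i = j
  · obtain ⟨i, rfl⟩ := hj
    exact h i
  · exact hP j fun i hi ↦ hj ⟨i, hi⟩

include huu₁ hvv₁ huv₁ huu₂ hvv₂ huv₂ hσ hdσ in
/-- **`E_Z(R_ℝ x, R_ℝ y) = −E_Y(x, y)`**: in symplectic coordinates `E = Σ dᵢ(xᵢy′ᵢ − x′ᵢyᵢ)`
(`(0 D; −D 0)`), and `R` swaps `xᵢ ↔ x′ᵢ` into the slots `σ(i)` where `d′_{σ i} = dᵢ`, the unmatched slots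
carrying `0` — «`r` … is the antisymplectic isomorphism that exchanges the factors».
[cite: IribarLopez2024NoetherLefschetzCycles, §2.2 Def. 4 (p. 8)] [cite: Lange2023AbelianVarietiesComplex, §1.5.1 (the matrix `(0 D; −D 0)`, chunk p0051)] -/
theorem twoForm_levelSwapMatrix_mulVec (x y : ι₁ → ℝ) :
    ω₂ ![Φ₂ ((levelSwapMatrix e₁ e₂ σ b₁ b₂).map (Int.cast : ℤ → ℝ) *ᵥ x),
        Φ₂ ((levelSwapMatrix e₁ e₂ σ b₁ b₂).map (Int.cast : ℤ → ℝ) *ᵥ y)] = -ω₁ ![Φ₁ x, Φ₁ y] := by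
  rw [twoForm_eq_sum_symplecticCoord huu₂ hvv₂ huv₂, twoForm_eq_sum_symplecticCoord huu₁ hvv₁ huv₁,
    sum_eq_sum_comp_of_injective hσ _ fun j hj ↦ by
      rw [repr_levelSwapMatrix_mulVec_inl_of_forall_ne e₁ e₂ σ b₁ b₂ x hj,
        repr_levelSwapMatrix_mulVec_inr_of_forall_ne e₁ e₂ σ b₁ b₂ x hj, zero_mul, zero_mul, sub_self, mul_zero],
    ← Finset.sum_neg_distrib]
  refine Finset.sum_congr rfl fun i _ ↦ ?_
  rw [repr_levelSwapMatrix_mulVec_inl e₁ e₂ σ b₁ b₂ hσ, repr_levelSwapMatrix_mulVec_inr e₁ e₂ σ b₁ b₂ hσ,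
    repr_levelSwapMatrix_mulVec_inl e₁ e₂ σ b₁ b₂ hσ, repr_levelSwapMatrix_mulVec_inr e₁ e₂ σ b₁ b₂ hσ, hdσ]
  ring

/-! ### §3 `ρ(R)` maps `K(θ_Y)` isomorphically onto `K(θ_Z)` -/

variable {G₁ : Matrix ι₁ ι₁ ℤ} {G₂ : Matrix ι₂ ι₂ ℤ}
  (hG₁ : G₁.map (Int.cast : ℤ → ℝ) = latticeGram Φ₁ ω₁) (hG₂ : G₂.map (Int.cast : ℤ → ℝ) = latticeGram Φ₂ ω₂)

include hG₁ hG₂ huu₁ hvv₁ huv₁ huu₂ hvv₂ huv₂ hσ hdσ in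
/-- **`ρ(R) x̄ ∈ K(θ_Z) ↔ x̄ ∈ K(θ_Y)`**: `K(L) = {dᵢxᵢ ∈ ℤ, dᵢx′ᵢ ∈ ℤ}` in symplectic coordinates
(Exercise 1.5.5 (5)), the coordinates of `R_ℝ x` are those of `x` at the matched slots (`d′_{σ i} = dᵢ`) and `0`
at the unmatched ones. [cite: IribarLopez2024NoetherLefschetzCycles, §2.2 Def. 4 (p. 8: `r : K(δ) → K(δ̃)`)] [cite: Lange2023AbelianVarietiesComplex, §1.5.4 Exercise 1.5.5 (5) (chunk p0060)] -/
theorem proj_levelSwapMatrix_mulVec_mem_kerPhiH_iff (x : ι₁ → ℝ) :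
    proj Φ₂ ((levelSwapMatrix e₁ e₂ σ b₁ b₂).map (Int.cast : ℤ → ℝ) *ᵥ x) ∈ kerPhiH Φ₂ G₂ ↔
      proj Φ₁ x ∈ kerPhiH Φ₁ G₁ := by
  rw [proj_mem_kerPhiH_iff_coord hG₂ huu₂ hvv₂ huv₂, proj_mem_kerPhiH_iff_coord hG₁ huu₁ hvv₁ huv₁]
  have h1 : (∀ j, ∃ m : ℤ, (d' j : ℝ) * (realLatticeBasis b₂).repr
      ((levelSwapMatrix e₁ e₂ σ b₁ b₂).map (Int.cast : ℤ → ℝ) *ᵥ x) (e₂ (Sum.inl j)) = m) ↔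
      ∀ i, ∃ m : ℤ, (d i : ℝ) * (realLatticeBasis b₁).repr x (e₁ (Sum.inr i)) = m := by
    rw [forall_iff_forall_comp (σ := σ) (fun j ↦ ∃ m : ℤ, (d' j : ℝ) * (realLatticeBasis b₂).repr
      ((levelSwapMatrix e₁ e₂ σ b₁ b₂).map (Int.cast : ℤ → ℝ) *ᵥ x) (e₂ (Sum.inl j)) = m) fun j hj ↦ ⟨0, by
        rw [repr_levelSwapMatrix_mulVec_inl_of_forall_ne e₁ e₂ σ b₁ b₂ x hj, mul_zero, Int.cast_zero]⟩]
    simp only [repr_levelSwapMatrix_mulVec_inl e₁ e₂ σ b₁ b₂ hσ, hdσ]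
  have h2 : (∀ j, ∃ m : ℤ, (d' j : ℝ) * (realLatticeBasis b₂).repr
      ((levelSwapMatrix e₁ e₂ σ b₁ b₂).map (Int.cast : ℤ → ℝ) *ᵥ x) (e₂ (Sum.inr j)) = m) ↔
      ∀ i, ∃ m : ℤ, (d i : ℝ) * (realLatticeBasis b₁).repr x (e₁ (Sum.inl i)) = m := by
    rw [forall_iff_forall_comp (σ := σ) (fun j ↦ ∃ m : ℤ, (d' j : ℝ) * (realLatticeBasis b₂).repr
      ((levelSwapMatrix e₁ e₂ σ b₁ b₂).map (Int.cast : ℤ → ℝ) *ᵥ x) (e₂ (Sum.inr j)) = m) fun j hj ↦ ⟨0, by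
        rw [repr_levelSwapMatrix_mulVec_inr_of_forall_ne e₁ e₂ σ b₁ b₂ x hj, mul_zero, Int.cast_zero]⟩]
    simp only [repr_levelSwapMatrix_mulVec_inr e₁ e₂ σ b₁ b₂ hσ, hdσ]
  rw [h1, h2]
  exact and_comm

include hG₁ hG₂ huu₁ hvv₁ huv₁ huu₂ hvv₂ huv₂ hσ hdσ in
/-- The same for points of the torus: `ρ(R) t ∈ K(θ_Z) ↔ t ∈ K(θ_Y)`. [cite: IribarLopez2024NoetherLefschetzCycles, §2.2 Def. 4 (p. 8)] -/
theorem mapMatrix_levelSwapMatrix_mem_kerPhiH_iff (t : ComplexTorus Φ₁) :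
    mapMatrix Φ₁ Φ₂ (levelSwapMatrix e₁ e₂ σ b₁ b₂) t ∈ kerPhiH Φ₂ G₂ ↔ t ∈ kerPhiH Φ₁ G₁ := by
  obtain ⟨x, rfl⟩ : ∃ x, proj Φ₁ x = t := ⟨lift Φ₁ t, proj_lift Φ₁ t⟩
  rw [mapMatrix_proj]
  exact proj_levelSwapMatrix_mulVec_mem_kerPhiH_iff huu₁ hvv₁ huv₁ huu₂ hvv₂ huv₂ hσ hdσ hG₁ hG₂ x

include hσ in
/-- **`ρ(R) : Y → Z` is injective** (as a homomorphism of real tori): `R_ℝ x ∈ Λ_Z` forces all coordinates of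
`x` — which are coordinates of `R_ℝ x` — to be integers. [cite: IribarLopez2024NoetherLefschetzCycles, §2.2 Def. 4 (p. 8: `r` is an isomorphism)] [cite: Lange2023AbelianVarietiesComplex, §1.5.1 (chunk p0051)] -/
theorem mapMatrix_levelSwapMatrix_injective : Injective (mapMatrix Φ₁ Φ₂ (levelSwapMatrix e₁ e₂ σ b₁ b₂)) := by
  change Injective (mapMatrixHom Φ₁ Φ₂ (levelSwapMatrix e₁ e₂ σ b₁ b₂))
  refine (injective_iff_map_eq_zero _).2 fun t ht ↦ ?_
  rw [mapMatrixHom_apply] at ht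
  obtain ⟨x, rfl⟩ : ∃ x, proj Φ₁ x = t := ⟨lift Φ₁ t, proj_lift Φ₁ t⟩
  rw [mapMatrix_proj, proj_eq_zero_iff] at ht
  obtain ⟨n, hn⟩ := ht
  rw [proj_eq_zero_iff]
  refine exists_intVec_eq_of_forall_repr b₁ _ fun k ↦ ⟨b₂.repr n (levelSwapIndex e₁ e₂ σ k), ?_⟩
  rw [← repr_levelSwapMatrix_mulVec_levelSwapIndex e₁ e₂ σ b₁ b₂ hσ x k, hn, realLatticeBasis_repr_intVec]

include hG₁ hG₂ huu₁ hvv₁ huv₁ huu₂ hvv₂ huv₂ hσ hdσ in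
/-- **`ρ(R)` maps `K(θ_Y)` ONTO `K(θ_Z)`** when the unmatched entries of the type of `Z` are `1`: a point
`ȳ ∈ K(θ_Z)` has `d′ⱼy_j, d′ⱼy′ⱼ ∈ ℤ`, so INTEGER coordinates at the unmatched slots (`d′ⱼ = 1`); subtracting that
lattice vector, `ȳ = ρ(R) x̄` for the point `x̄` of `Y` carrying the matched coordinates, and `x̄ ∈ K(θ_Y)`
(`K(δ̃) = K(δ)`: «the antisymplectic isomorphism `r : K(δ) → K(δ̃) = K(δ)`»).
[cite: IribarLopez2024NoetherLefschetzCycles, §2.2 Def. 4 (p. 8)] [cite: Lange2023AbelianVarietiesComplex, §1.5.4 Exercise 1.5.5 (5) (chunk p0060)] -/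
theorem exists_mapMatrix_levelSwapMatrix_eq_of_mem_kerPhiH (hd1 : ∀ j, (∀ i, σ i ≠ j) → d' j = 1)
    {s : ComplexTorus Φ₂} (hs : s ∈ kerPhiH Φ₂ G₂) :
    ∃ t ∈ kerPhiH Φ₁ G₁, mapMatrix Φ₁ Φ₂ (levelSwapMatrix e₁ e₂ σ b₁ b₂) t = s := by
  obtain ⟨y, rfl⟩ : ∃ y, proj Φ₂ y = s := ⟨lift Φ₂ s, proj_lift Φ₂ s⟩
  have hy := (proj_mem_kerPhiH_iff_coord hG₂ huu₂ hvv₂ huv₂ y).1 hs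
  -- the point of `Y` with the matched coordinates of `y`
  set x : ι₁ → ℝ := ∑ k, (realLatticeBasis b₂).repr y (levelSwapIndex e₁ e₂ σ k) • realLatticeBasis b₁ k with hx
  have hxk : ∀ k, (realLatticeBasis b₁).repr x k = (realLatticeBasis b₂).repr y (levelSwapIndex e₁ e₂ σ k) :=
    fun k ↦ by rw [hx, Basis.repr_sum_self]
  -- `y − R_ℝ x` is a lattice vector
  have hcoord : ∀ k', ∃ m : ℤ, (realLatticeBasis b₂).repr
      (y - (levelSwapMatrix e₁ e₂ σ b₁ b₂).map (Int.cast : ℤ → ℝ) *ᵥ x) k' = m := by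
    intro k'
    rw [map_sub, Finsupp.sub_apply]
    obtain ⟨s', rfl⟩ := e₂.surjective k'
    cases s' with
    | inl j =>
      by_cases hj : ∃ i, σ i = j
      · obtain ⟨i, rfl⟩ := hj
        exact ⟨0, by rw [repr_levelSwapMatrix_mulVec_inl e₁ e₂ σ b₁ b₂ hσ, hxk, levelSwapIndex_inr, sub_self,
          Int.cast_zero]⟩
      · have hj' : ∀ i, σ i ≠ j := fun i hi ↦ hj ⟨i, hi⟩
        obtain ⟨m, hm⟩ := hy.1 j
        rw [hd1 j hj', Nat.cast_one, one_mul] at hm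
        exact ⟨m, by rw [repr_levelSwapMatrix_mulVec_inl_of_forall_ne e₁ e₂ σ b₁ b₂ x hj', sub_zero, hm]⟩
    | inr j =>
      by_cases hj : ∃ i, σ i = j
      · obtain ⟨i, rfl⟩ := hj
        exact ⟨0, by rw [repr_levelSwapMatrix_mulVec_inr e₁ e₂ σ b₁ b₂ hσ, hxk, levelSwapIndex_inl, sub_self,
          Int.cast_zero]⟩
      · have hj' : ∀ i, σ i ≠ j := fun i hi ↦ hj ⟨i, hi⟩
        obtain ⟨m, hm⟩ := hy.2 j
        rw [hd1 j hj', Nat.cast_one, one_mul] at hm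
        exact ⟨m, by rw [repr_levelSwapMatrix_mulVec_inr_of_forall_ne e₁ e₂ σ b₁ b₂ x hj', sub_zero, hm]⟩
  obtain ⟨n, hn⟩ := exists_intVec_eq_of_forall_repr b₂ _ hcoord
  have hRx : proj Φ₂ ((levelSwapMatrix e₁ e₂ σ b₁ b₂).map (Int.cast : ℤ → ℝ) *ᵥ x) = proj Φ₂ y :=
    (proj_eq_proj_iff_exists_intVec Φ₂).2 ⟨n, sub_eq_iff_eq_add'.1 hn⟩
  refine ⟨proj Φ₁ x, ?_, by rw [mapMatrix_proj, hRx]⟩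
  rw [← proj_levelSwapMatrix_mulVec_mem_kerPhiH_iff huu₁ hvv₁ huv₁ huu₂ hvv₂ huv₂ hσ hdσ hG₁ hG₂, hRx]
  exact hs

/-! ### §4 `ẽ^{θ_Z}(R s, R t) = ẽ^{θ_Y}(s, t)⁻¹`: `ρ(R)` is antisymplectic for the Weil pairings -/

include hG₁ hG₂ huu₁ hvv₁ huv₁ huu₂ hvv₂ huv₂ hσ hdσ in
/-- **`ρ(R)|_{K(θ_Y)}` is ANTISYMPLECTIC**: `ẽ^{θ_Z}(R s̄, R t̄) = e(−2πi E_Z(Rs, Rt)) = e(2πi E_Y(s, t)) =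
ẽ^{θ_Y}(s̄, t̄)⁻¹` (Thm. 2.7.7 / (2.13): `ẽ^L(x̄, ȳ) = e(−2πi E(x, y))` on `K(L)`).
[cite: IribarLopez2024NoetherLefschetzCycles, §2.2 Def. 4 (p. 8: «the antisymplectic isomorphism `r`»)] [cite: Lange2023AbelianVarietiesComplex, §2.7.1 (2.13) and Thm. 2.7.7 (chunks p0148, p0152)] -/
theorem weilPairing_mapMatrix_levelSwapMatrix {s t : ComplexTorus Φ₁} (hs : s ∈ kerPhiH Φ₁ G₁)
    (ht : t ∈ kerPhiH Φ₁ G₁) :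
    weilPairing Φ₂ ω₂ (mapMatrix Φ₁ Φ₂ (levelSwapMatrix e₁ e₂ σ b₁ b₂) s)
        (mapMatrix Φ₁ Φ₂ (levelSwapMatrix e₁ e₂ σ b₁ b₂) t) = (weilPairing Φ₁ ω₁ s t)⁻¹ := by
  obtain ⟨x, rfl⟩ : ∃ x, proj Φ₁ x = s := ⟨lift Φ₁ s, proj_lift Φ₁ s⟩
  obtain ⟨y, rfl⟩ : ∃ y, proj Φ₁ y = t := ⟨lift Φ₁ t, proj_lift Φ₁ t⟩
  have hRx := (proj_levelSwapMatrix_mulVec_mem_kerPhiH_iff huu₁ hvv₁ huv₁ huu₂ hvv₂ huv₂ hσ hdσ hG₁ hG₂ x).2 hs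
  have hRy := (proj_levelSwapMatrix_mulVec_mem_kerPhiH_iff huu₁ hvv₁ huv₁ huu₂ hvv₂ huv₂ hσ hdσ hG₁ hG₂ y).2 ht
  rw [mapMatrix_proj, mapMatrix_proj, weilPairing_proj_proj Φ₂ ω₂ hG₂ hRx hRy,
    weilPairing_proj_proj Φ₁ ω₁ hG₁ hs ht, weilPairingFun_apply, weilPairingFun_apply,
    twoForm_levelSwapMatrix_mulVec huu₁ hvv₁ huv₁ huu₂ hvv₂ huv₂ hσ hdσ, ← Complex.exp_neg]
  congr 1
  push_cast
  ring

/-! ### §5 The antisymplectic isomorphism `p = ρ(R)|_{K(θ_Y)} : K(θ_Y) ≃ K(θ_Z)` -/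

include hG₁ hG₂ huu₁ hvv₁ huv₁ huu₂ hvv₂ huv₂ hσ hdσ in
/-- **`f_Z ∘ r ∘ f_Y⁻¹ : K(θ_Y) ≅ K(θ_Z)` is an antisymplectic isomorphism**: for symplectic bases of `Λ_Y` of
type `d = (d₁, …, d_u)` and of `Λ_Z` of type `d′` with `d′ ∘ σ = d` for an injection `σ` and `d′ⱼ = 1` at the
unmatched indices, the restriction of `ρ(R)` is an isomorphism `p : K(θ_Y) ≃+ K(θ_Z)` with
`ẽ^{θ_Z}(p s, p t) = ẽ^{θ_Y}(s, t)⁻¹` (tree `IsAntisymplectic`).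
[cite: IribarLopez2024NoetherLefschetzCycles, §2.2 Def. 4 (p. 8)] [cite: Auffarth2016NonSimplePPAV, §3 (the anti-symplectic `ε : K(D) → K(D̃)`)] -/
theorem exists_antisymplectic_addEquiv_kerPhiH (hd1 : ∀ j, (∀ i, σ i ≠ j) → d' j = 1) :
    ∃ p : kerPhiH Φ₁ G₁ ≃+ kerPhiH Φ₂ G₂, IsAntisymplectic ω₁ ω₂ p.toAddMonoidHom ∧
      ∀ t, (p t : ComplexTorus Φ₂) = mapMatrix Φ₁ Φ₂ (levelSwapMatrix e₁ e₂ σ b₁ b₂) t := by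
  set q : kerPhiH Φ₁ G₁ →+ kerPhiH Φ₂ G₂ :=
    ((mapMatrixHom Φ₁ Φ₂ (levelSwapMatrix e₁ e₂ σ b₁ b₂)).restrict (kerPhiH Φ₁ G₁)).codRestrict (kerPhiH Φ₂ G₂)
      fun t ↦ (mapMatrix_levelSwapMatrix_mem_kerPhiH_iff huu₁ hvv₁ huv₁ huu₂ hvv₂ huv₂ hσ hdσ hG₁ hG₂ _).2 t.2
    with hq
  have hq_apply : ∀ t : kerPhiH Φ₁ G₁, (q t : ComplexTorus Φ₂) =
      mapMatrix Φ₁ Φ₂ (levelSwapMatrix e₁ e₂ σ b₁ b₂) t := fun t ↦ rfl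
  have hinj : Injective q := fun s t h ↦ Subtype.ext
    (mapMatrix_levelSwapMatrix_injective hσ (by rw [← hq_apply, ← hq_apply, h]))
  have hsurj : Surjective q := fun s ↦ by
    obtain ⟨t, ht, hts⟩ := exists_mapMatrix_levelSwapMatrix_eq_of_mem_kerPhiH huu₁ hvv₁ huv₁ huu₂ hvv₂ huv₂ hσ hdσ
      hG₁ hG₂ hd1 s.2
    exact ⟨⟨t, ht⟩, Subtype.ext (by rw [hq_apply, hts])⟩
  refine ⟨AddEquiv.ofBijective q ⟨hinj, hsurj⟩, fun s t ↦ ?_, fun t ↦ rfl⟩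
  change weilPairing Φ₂ ω₂ (q s : ComplexTorus Φ₂) (q t) = _
  rw [hq_apply, hq_apply]
  exact weilPairing_mapMatrix_levelSwapMatrix huu₁ hvv₁ huv₁ huu₂ hvv₂ huv₂ hσ hdσ hG₁ hG₂ s.2 t.2

end Form

/-! ### §6 In the language of types: `δ` and `δ̃ = (1^k, δ)`, or equal types -/

section Types

variable {G₁ : Matrix ι₁ ι₁ ℤ} {G₂ : Matrix ι₂ ι₂ ℤ}
  (hG₁ : G₁.map (Int.cast : ℤ → ℝ) = latticeGram Φ₁ ω₁) (hG₂ : G₂.map (Int.cast : ℤ → ℝ) = latticeGram Φ₂ ω₂)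

omit [DecidableEq ι₁] in
/-- A type `(d₁, …, d_g)` comes with a symplectic basis indexed through `Fin g ⊕ Fin g ≃ ι` (re-indexing the
tree's `IsPolarizationType` basis, as in `IsPolarizationType.exists_isotropic_kerPhiH_decomposition`).
[cite: Lange2023AbelianVarietiesComplex, §1.5.1 (chunk p0051)] -/
theorem IsPolarizationType.exists_equiv_basis {g : ℕ} {d : Fin g → ℕ} (h : IsPolarizationType Φ₁ ω₁ d) :
    ∃ (e : Fin g ⊕ Fin g ≃ ι₁) (b : Basis ι₁ ℤ (ι₁ → ℤ)),
      (∀ i j, ω₁ ![Φ₁ (intVec (b (e (Sum.inl i)))), Φ₁ (intVec (b (e (Sum.inl j))))] = 0) ∧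
      (∀ i j, ω₁ ![Φ₁ (intVec (b (e (Sum.inr i)))), Φ₁ (intVec (b (e (Sum.inr j))))] = 0) ∧
      (∀ i j, ω₁ ![Φ₁ (intVec (b (e (Sum.inl i)))), Φ₁ (intVec (b (e (Sum.inr j))))] =
        if i = j then (d i : ℝ) else 0) := by
  obtain ⟨-, b₀, huu, hvv, huv⟩ := h
  let e : Fin g ⊕ Fin g ≃ ι₁ := b₀.indexEquiv (Pi.basisFun ℤ ι₁)
  let b : Basis ι₁ ℤ (ι₁ → ℤ) := b₀.reindex e
  have hb : ∀ s, b (e s) = b₀ s := fun s ↦ by simp [b]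
  exact ⟨e, b, fun i j ↦ by rw [hb, hb]; exact huu i j, fun i j ↦ by rw [hb, hb]; exact hvv i j,
    fun i j ↦ by rw [hb, hb]; exact huv i j⟩

include hG₁ hG₂ in
/-- **Antisymplectic `K(θ_Y) ≅ K(θ_Z)` for matched types**: if `(Y, ω₁)` is of type `d = (d₁, …, d_u)` and
`(Z, ω₂)` of type `d′ = (d′₁, …, d′_v)` with `d′_{σ i} = dᵢ` along an injection `σ` and `d′ⱼ = 1` elsewhere,
there is an antisymplectic isomorphism `K(θ_Y) ≅ K(θ_Z)`. [cite: IribarLopez2024NoetherLefschetzCycles, §2.2 Def. 4 (p. 8)] [cite: Auffarth2016NonSimplePPAV, §3] -/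
theorem IsPolarizationType.exists_antisymplectic_addEquiv_kerPhiH {d : Fin u → ℕ} {d' : Fin v → ℕ}
    (hd : IsPolarizationType Φ₁ ω₁ d) (hd' : IsPolarizationType Φ₂ ω₂ d') (σ : Fin u → Fin v) (hσ : Injective σ)
    (hdσ : ∀ i, d' (σ i) = d i) (hd1 : ∀ j, (∀ i, σ i ≠ j) → d' j = 1) :
    ∃ p : kerPhiH Φ₁ G₁ ≃+ kerPhiH Φ₂ G₂, IsAntisymplectic ω₁ ω₂ p.toAddMonoidHom := by
  obtain ⟨e₁, b₁, huu₁, hvv₁, huv₁⟩ := hd.exists_equiv_basis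
  obtain ⟨e₂, b₂, huu₂, hvv₂, huv₂⟩ := hd'.exists_equiv_basis
  obtain ⟨p, hp, -⟩ := ComplexTorus.exists_antisymplectic_addEquiv_kerPhiH huu₁ hvv₁ huv₁ huu₂ hvv₂ huv₂
    hσ hdσ hG₁ hG₂ hd1
  exact ⟨p, hp⟩

include hG₁ hG₂ in
/-- **Antisymplectic `K(θ_Y) ≅ K(θ_Z)` for the complementary types `δ = (d₁, …, d_u)` and
`δ̃ = (1, …, 1, d₁, …, d_u)`** (`k` ones; Iribar López's `K(δ̃) = K(δ)` and `r : K(δ) → K(δ̃)`): for `(Y, ω₁)` of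
type `δ` and `(Z, ω₂)` of type `δ̃` there is an antisymplectic isomorphism `K(θ_Y) ≅ K(θ_Z)` — the input
`f_Z ∘ r ∘ f_Y⁻¹` of Lemma 10 exists for EVERY such pair.
[cite: IribarLopez2024NoetherLefschetzCycles, §2.2 Def. 4 (p. 8) and §2.2 (p. 7: complementary type)] [cite: Auffarth2016NonSimplePPAV, §3 (`K(D) = K(D̃)`, `ε`)] -/
theorem IsPolarizationType.exists_antisymplectic_addEquiv_kerPhiH_append {k : ℕ} {d : Fin u → ℕ}
    (hd : IsPolarizationType Φ₁ ω₁ d) (hd' : IsPolarizationType Φ₂ ω₂ (Fin.append (fun _ : Fin k ↦ 1) d)) :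
    ∃ p : kerPhiH Φ₁ G₁ ≃+ kerPhiH Φ₂ G₂, IsAntisymplectic ω₁ ω₂ p.toAddMonoidHom := by
  refine hd.exists_antisymplectic_addEquiv_kerPhiH hG₁ hG₂ hd' (Fin.natAdd k) (fun i j h ↦ ?_)
    (fun i ↦ Fin.append_right _ _ i) fun j hj ↦ ?_
  · simpa using h
  · induction j using Fin.addCases with
    | left j => rw [Fin.append_left]
    | right i => exact absurd rfl (hj i)

include hG₁ hG₂ in
/-- **Antisymplectic `K(θ_Y) ≅ K(θ_Z)` for EQUAL types** (`σ = id`: e.g. two elliptic curves polarised with the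
same degree `d`, `p : E₁[d] ≅ E₂[d]`). [cite: IribarLopez2024NoetherLefschetzCycles, §2.2 Def. 4 (p. 8, the case `u = g/2`, Remark 11)] [cite: Auffarth2016NonSimplePPAV, §3] -/
theorem IsPolarizationType.exists_antisymplectic_addEquiv_kerPhiH_of_eq {d : Fin u → ℕ}
    (hd : IsPolarizationType Φ₁ ω₁ d) (hd' : IsPolarizationType Φ₂ ω₂ d) :
    ∃ p : kerPhiH Φ₁ G₁ ≃+ kerPhiH Φ₂ G₂, IsAntisymplectic ω₁ ω₂ p.toAddMonoidHom :=
  hd.exists_antisymplectic_addEquiv_kerPhiH hG₁ hG₂ hd' id injective_id (fun _ ↦ rfl)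
    fun j hj ↦ absurd rfl (hj j)

/-! ### §7 With FILE A: Debarre's `𝒫_{g,δ}` is defined on every pair of the complementary types -/

/-- **For every `(Y, ω₁)` of type `δ` and `(Z, ω₂)` of type `δ̃ = (1^k, δ)` there is a principally polarised
twisted product `((Y × Z)/graph(p), ω₁ ⊠ ω₂ descended)`**, `p : K(L₁) → K(L₂)` bijective antisymplectic
(`𝒫_{g,δ}((Y, θ_Y, f_Y), (Z, θ_Z, f_Z)) = ((Y × Z)/graph(f_Z ∘ r ∘ f_Y⁻¹), θ)`; FILE A's
`isPrincipalPolarization_quotientBy_graphSubgroup` for the `p` of §6).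
[cite: IribarLopez2024NoetherLefschetzCycles, §2.2 Lemma 10 and Def. 4 (pp. 7–8)] [cite: Auffarth2016NonSimplePPAV, §3 (`Φ_{u,n−u}(D) : 𝒜_u(D) × 𝒜_{n−u}(D̃) → 𝒜^D_{u,n−u}`)] [cite: Debarre1988ThetaSingulierCodim3, (the original construction)] -/
theorem IsPolarizationType.exists_isPrincipalPolarization_quotientBy_graphSubgroup_append
    (hω₁ : IsRiemannForm Φ₁ ω₁) (hω₂ : IsRiemannForm Φ₂ ω₂)
    (hG₁ : G₁.map (Int.cast : ℤ → ℝ) = latticeGram Φ₁ ω₁) (hG₂ : G₂.map (Int.cast : ℤ → ℝ) = latticeGram Φ₂ ω₂)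
    {k : ℕ} {d : Fin u → ℕ} (hd : IsPolarizationType Φ₁ ω₁ d)
    (hd' : IsPolarizationType Φ₂ ω₂ (Fin.append (fun _ : Fin k ↦ 1) d)) :
    ∃ (p : kerPhiH Φ₁ G₁ →+ kerPhiH Φ₂ G₂) (_ : Bijective p) (_ : IsAntisymplectic ω₁ ω₂ p)
      (_ : Finite (graphSubgroup (kerPhiH Φ₁ G₁) (kerPhiH Φ₂ G₂) p)),
      IsPrincipalPolarization (quotientByPeriod (prodPeriod Φ₁ Φ₂) (graphSubgroup (kerPhiH Φ₁ G₁) (kerPhiH Φ₂ G₂) p))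
        (prodForm ω₁ ω₂) := by
  obtain ⟨p, hp⟩ := hd.exists_antisymplectic_addEquiv_kerPhiH_append hG₁ hG₂ hd'
  haveI := hω₁.finite_graphSubgroup hG₁ p.toAddMonoidHom
  exact ⟨p.toAddMonoidHom, p.bijective, hp, inferInstance,
    isPrincipalPolarization_quotientBy_graphSubgroup hω₁ hω₂ hG₁ hG₂ p.bijective hp⟩

/-- The same for two polarised tori of EQUAL type (`δ̃ = δ`, `k = 0`, e.g. `g = 2u`).
[cite: IribarLopez2024NoetherLefschetzCycles, §2.2 Lemma 10, Def. 4 and Remark 11 (p. 8)] -/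
theorem IsPolarizationType.exists_isPrincipalPolarization_quotientBy_graphSubgroup_of_eq
    (hω₁ : IsRiemannForm Φ₁ ω₁) (hω₂ : IsRiemannForm Φ₂ ω₂)
    (hG₁ : G₁.map (Int.cast : ℤ → ℝ) = latticeGram Φ₁ ω₁) (hG₂ : G₂.map (Int.cast : ℤ → ℝ) = latticeGram Φ₂ ω₂)
    {d : Fin u → ℕ} (hd : IsPolarizationType Φ₁ ω₁ d) (hd' : IsPolarizationType Φ₂ ω₂ d) :
    ∃ (p : kerPhiH Φ₁ G₁ →+ kerPhiH Φ₂ G₂) (_ : Bijective p) (_ : IsAntisymplectic ω₁ ω₂ p)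
      (_ : Finite (graphSubgroup (kerPhiH Φ₁ G₁) (kerPhiH Φ₂ G₂) p)),
      IsPrincipalPolarization (quotientByPeriod (prodPeriod Φ₁ Φ₂) (graphSubgroup (kerPhiH Φ₁ G₁) (kerPhiH Φ₂ G₂) p))
        (prodForm ω₁ ω₂) := by
  obtain ⟨p, hp⟩ := hd.exists_antisymplectic_addEquiv_kerPhiH_of_eq hG₁ hG₂ hd'
  haveI := hω₁.finite_graphSubgroup hG₁ p.toAddMonoidHom
  exact ⟨p.toAddMonoidHom, p.bijective, hp, inferInstance,
    isPrincipalPolarization_quotientBy_graphSubgroup hω₁ hω₂ hG₁ hG₂ p.bijective hp⟩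

end Types

end ComplexTorus

end Literature.Geometry.Kaehler

end
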